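import Summits.AtomisticToContinuum.FouriersLaw.Theses.EmbeddedDrudeMourre
import Summits.AtomisticToContinuum.FouriersLaw.Theses.StaticAbelianSqueeze
import Literature.MathematicalPhysics.KineticTheory.LangevinChainKernel
import Literature.MathematicalPhysics.KineticTheory.LangevinChainGibbs
import Literature.MathematicalPhysics.KineticTheory.LangevinChainNESSHolds
import Literature.MathematicalPhysics.KineticTheory.InfiniteChainSuperstableDynamics
import Literature.MathematicalPhysics.KineticTheory.InfiniteChainInvariantStates
import Literature.MathematicalPhysics.KineticTheory.InfiniteChainSuperstableOrbits
import Literature.MathematicalPhysics.KineticTheory.InfiniteChainTightRegular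
import Summits.AtomisticToContinuum.FouriersLaw.Theorems.StaticAbelianSqueezeKuboAbelIdentity
import Summits.AtomisticToContinuum.FouriersLaw.Theorems.FourierGreenKuboFourierFiniteResponseOfUnique
import Summits.AtomisticToContinuum.FouriersLaw.Theorems.EmbeddedDrudeMourreGreenKuboContinuationCanonicalSeedOfRegularState
import Summits.AtomisticToContinuum.FouriersLaw.Theorems.EmbeddedDrudeMourreGreenKuboContinuationHeatableInfrastructure
import Summits.AtomisticToContinuum.FouriersLaw.Theorems.EmbeddedDrudeMourreAbelThermodynamicLimitKaramataRieszTwo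
import Summits.AtomisticToContinuum.FouriersLaw.Theorems.EmbeddedDrudeMourreAbelThermodynamicLimitWitnessPositiveType
import Summits.AtomisticToContinuum.FouriersLaw.Theorems.EmbeddedDrudeMourreAbelThermodynamicLimitRegularDLRUnique
import Summits.AtomisticToContinuum.FouriersLaw.Theorems.EmbeddedDrudeMourreAbelThermodynamicLimitFixedHorizonMatchingWindowLeaves
import Summits.AtomisticToContinuum.FouriersLaw.Theorems.EmbeddedDrudeMourreAbelThermodynamicLimitAnchoredKubo
import Summits.AtomisticToContinuum.FouriersLaw.Theorems.EmbeddedDrudeMourreAbelThermodynamicLimitAnchoredKuboUniformMixing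
import Summits.AtomisticToContinuum.FouriersLaw.Theorems.EmbeddedDrudeMourreAbelThermodynamicLimitUniformMixing
import Summits.AtomisticToContinuum.FouriersLaw.Theorems.EmbeddedDrudeMourreAbelThermodynamicLimitAnchoredCorrelationTails
import Summits.AtomisticToContinuum.FouriersLaw.Theorems.EmbeddedDrudeMourreAbelThermodynamicLimitFixedTimeOffsetMatching
import Summits.AtomisticToContinuum.FouriersLaw.Theorems.EmbeddedDrudeMourreAbelThermodynamicLimitFixedFrequencyMatching
import Summits.AtomisticToContinuum.FouriersLaw.Theorems.EmbeddedDrudeMourreAbelThermodynamicLimitAnchoredDcLimitOfRegularity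
import Summits.AtomisticToContinuum.FouriersLaw.Theorems.EmbeddedDrudeMourreAbelThermodynamicLimitAnchoredPostDarkOfDcLimit

/-!
# Line `loomis-compact-horizon-witness` — LEAD'S SKELETON (rev 5) for crux
`EmbeddedDrudeMourre.AbelThermodynamicLimit` (stmt-AtomisticToContinuum-12596)

Continuation lead `prover-line-stmt-AtomisticToContinuum-12596-c2-0`, 2026-08-16 (rev 5, 22:00Z), over lead c1's rev 4
(21:10Z; rev-4 text kept below where unchanged).

Crux (FIXED): `Summit.AtomisticToContinuum.FouriersLaw.Theses.EmbeddedDrudeMourre.AbelThermodynamicLimit`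
(`Iff.rfl`-identical to `LatticeLandauDamping.AbelThermodynamicLimit`, stmt-14013).

## State inherited (rev 4): the infrastructure AND the rev-4 real analysis are theorems
S1 Karamata (p87844), S2 positive type (p91227), S7 regular DLR uniqueness (p104271), S3 anchored Kubo (p93721 + p106951),
S4 fixed-horizon matching (p95337 + p119825 + p124322), (M) fixed-frequency matching (p127009), A anchored DC limit of
regularity (p126906), B post-dark of DC limit (p126788).  rev 4 was open EXACTLY at the seam SI `stub_witnessShiftInvariant`
("WLOG the witness state is shift-invariant"; undecidable in the tree as typed — the planner-level repair of the crux) and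
the core (R) `stub_uniformAbelianRegularity` = `StaticAbelianSqueeze.UniformAbelianRegularity` (stmt-13416).

## rev 5 — what changed and why (lead c2): THE SEAM IS NOT LOAD-BEARING
* OBSERVATION.  Modulo (R) (and the landed (M), A, S3) the crux's conclusion is decided by ONE real number: along every
  steady family `T²·Dn N = A_N(0) → L` (S3 + A), and for the unconditional regular pair `(μ*, D*)` (`exists_regularPair`:
  transfer-operator state + Buttà–Marchioro flow, landed) `∫₀^∞ e^{-νt} C_{D*}(t) dt → L` (`ν ↓ 0`) ((M) + A).  Hence
  `(μ*, D*, L/T²)` is an Abelian Green–Kubo witness with `Dn → L/T²` for EVERY steady family — provided only `0 < L`.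
  Conversely the crux forces `0 < L` whenever a witness exists (`Dn → κ > 0`).  So, modulo (R):
  crux ⟺ [an Abelian witness exists ⇒ `liminf_N D_N > 0`]  (`lowerBound_of_crux` = landed `stub_lowerBoundOfCrux`, p127832).
  The given witness is otherwise IDLE (Disproof §2a: the hypothesis is `γ`-blind), and the seam SI is SUFFICIENT for
  positivity (`L = T²κ`; `AbelThermodynamicLimitSI_of` = landed `stub_repairedCruxOfRegularity` p127832: the REPAIRED crux ⇐ (R) alone) but
  not necessary.  NECESSITY of (R) for every REGULAR witness with `Dn → κ`: NEC-R `stub_regularityAtOfRegularWitness` (landed p127891);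
  hence modulo the seam the residual {(R), CLB} is crux-EQUIVALENT.
* NEW STUB **CLB `stub_conductanceLowerBound` := `StaticAbelianSqueeze.ConductanceLowerBound` BY NAME** (item
  stmt-AtomisticToContinuum-11749, refuter-vetted, lead-served in its own crux chain): `∃ c > 0`, `D_N ≥ c` eventually,
  along every steady family.  NECESSARY for the crux given a witness (above) and for the conjunct; applied to the CANONICAL
  steady family (`pinnedChain_exists_isSteadyState`, CEHR 2018, landed) and its responses (`finiteResponse_of_unique`,
  landed) it gives `L ≥ T²c > 0`.
* SI is DROPPED from the stub set (nothing landed is lost: SI was never landed; (WT) ⇒ SI ⇒ repaired crux stay recorded as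
  `AbelThermodynamicLimitSI_of`).  (M), A, B are CLOSED (tree theorems, referenced by name).
* COMPOSITION (`AbelThermodynamicLimit_of`, kernel-checked) = the LANDED certificate `stub_cruxOfRegularityOfLowerBound` (p127832:
  regular pair; (M) (fed S7); A (fed (R)) ⇒ `L`; S3 along the canonical family + CLB ⇒ `0 < L`; OUTPUT `(μ*, D*, L/T²)`; S3 along the
  given family ⇒ `Dn → L/T²`) applied to the two stubs.
* OPEN after rev 5: **(R) = stmt-13416** (the `ν ↓ 0 ↔ N → ∞` exchange; Disproof §4 (3); open-problem class) and
  **CLB = stmt-11749** (`liminf D_N > 0`; open-problem class) — BOTH EXISTING, FILED, NECESSARY items; no unfiled residual.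
  `sorry` occurs ONLY in `stub_uniformAbelianRegularity`, `stub_conductanceLowerBound`.  Landed this cycle (lead c2): p127832
  (`…Theorems.EmbeddedDrudeMourreAbelThermodynamicLimitOfLowerBound`: stub_cruxOfRegularityOfLowerBound, stub_lowerBoundOfCrux,
  stub_repairedCruxOfRegularity, exists_steadyFamily_response, exists_regularPair, exists_regularPair_commonLimit_of_regularity), p127891
  (`…RegularityOfRegularWitness`: NEC-R stub_regularityAtOfRegularWitness, eventually_flat_of_tendsto, exists_restrict_bmGood).
* S5 (anchored post-dark stability, the line's rev-3 residual) is now derived from (R) ALONE (B ∘ A ∘ (M) on the regular pair).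

## Disproof used (`Cruxes/AbelThermodynamicLimit/Disproof.lean`, cdisprove v5 + §7 seat 14013, rc 0; re-read 2026-08-16T21:45Z:
no `-- Targets` section; landed `Negative/LoadBearing.lean`, `Negative/SignLawsKillCriteria.lean` instantiate no stub here)
§2a γ-blindness: `γ`, `Uniq` act only in S3, CLB and inside the open-chain kernels of (R), (M) — and rev 5 makes the
γ-blind witness hypothesis literally idle; §2b `0 < T` carried by every stub; §2c harmonic corner: (R) fails there
(`∫₀^∞ c_N ∼ N²`), CLB HOLDS there (crux CLB's `Negative/HarmonicCornerLowerBound`: `D_N ≥ c`, ballistic) — so `lam, β > 0` act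
exactly at (R), as §4 (3) requires; §3 `HasBoundedResponse` = upper half of (R); CLB = the conjunct's positivity half
(crux CLB's `Negative/GammaZeroNonUniqueness`: false without baths-or-uniqueness, i.e. at `γ = 0`, matching §2a′).
-/

noncomputable section

open MeasureTheory Filter Set
open scoped Topology NNReal BigOperators

namespace Summit.AtomisticToContinuum.FouriersLaw.Cruxes.AbelThermodynamicLimit

namespace LoomisCompactHorizonWitness

open Literature.MathematicalPhysics.KineticTheory.HeatConduction

/-! ## Proof-side shorthand (NEVER used inside a stub signature) -/

/-- `⟨j_i(0) j_k(t)⟩_{N,T}`: equilibrium pair correlation of bond currents of the open `N`-chain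
(Gibbs measure `gibbsMeasure N T`, constructed kernels `transitionKernel N T T t`). -/
def pairCorr (ω₂ lam β γ T : ℝ) (N : ℕ) (i k : Fin N) (t : ℝ) : ℝ :=
  ∫ z, (pinnedChain ω₂ lam β γ).bondCurrent N i z *
      (∫ y, (pinnedChain ω₂ lam β γ).bondCurrent N k y
          ∂((pinnedChain ω₂ lam β γ).transitionKernel N T T t.toNNReal z))
    ∂((pinnedChain ω₂ lam β γ).gibbsMeasure N T)

/-- The central bond `c_N = ⌊(N-1)/2⌋`. -/
def centralBond (N : ℕ) (h : 2 ≤ N) : Fin N := ⟨(N - 1) / 2, by omega⟩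

/-- ANCHORED DC VALUE `A_N(0) = Σ_k ∫₀^∞ ⟨j_{c_N}(0) j_k(t)⟩_{N,T} dt` (junk `0` for `N < 2`). -/
def anchoredDC (ω₂ lam β γ T : ℝ) (N : ℕ) : ℝ :=
  if h : 2 ≤ N then
    ∑ k : Fin N, ∫ t in Ioi (0:ℝ), pairCorr ω₂ lam β γ T N (centralBond N h) k t
  else 0

/-- The ORDER-2 RIESZ MEAN over the compact horizon `[0, τ]`: `∫₀^τ (1 - t/τ)² f(t) dt`. -/
def rieszMean (f : ℝ → ℝ) (τ : ℝ) : ℝ :=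
  ∫ t in Ioc (0 : ℝ) τ, (1 - t / τ) ^ 2 * f t

/-- ANCHORED COMPACT-HORIZON FUNCTIONAL `W_N(τ) = Σ_k ∫₀^τ (1 - t/τ)² ⟨j_{c_N}(0) j_k(t)⟩_{N,T} dt`
(junk `0` for `N < 2`). -/
def anchoredRiesz (ω₂ lam β γ T : ℝ) (N : ℕ) (τ : ℝ) : ℝ :=
  if h : 2 ≤ N then
    ∑ k : Fin N, ∫ t in Ioc (0 : ℝ) τ, (1 - t / τ) ^ 2 * pairCorr ω₂ lam β γ T N (centralBond N h) k t
  else 0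


/-! ## rev-5 OPEN stubs: the core (R) and the positivity half CLB — `sorry` (both = existing items BY NAME) -/

/-- **(R) `stub_uniformAbelianRegularity` — THE CORE (OPEN; held by the lead): `StaticAbelianSqueeze.UniformAbelianRegularity`
BY NAME** (item stmt-AtomisticToContinuum-13416, refuter-vetted; closing that item closes this stub by `exact`).  For `P` (all
`> 0`), `T > 0`, every `ε > 0` there is `ν₀ > 0` such that for all `ν ∈ (0, ν₀)`, eventually in `N`,
`|∫₀^∞ (1 - e^{-νt}) c_N(t) dt| ≤ εN` (`c_N` = equilibrium total-current autocorrelation of the open `N`-chain, both baths at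
`T`): the slow part of the open chain's current noise carries `o(N)` weight UNIFORMLY in `ν < ν₀` — Disproof §4 step (3), the
`ν ↓ 0 ↔ N → ∞` exchange; its upper half is `HasBoundedResponse`-class, its lower half the DC-notch statement; fails at the
harmonic corner (`∫₀^∞ c_N ∼ N²`). -/
theorem stub_uniformAbelianRegularity :
    Summit.AtomisticToContinuum.FouriersLaw.Theses.StaticAbelianSqueeze.UniformAbelianRegularity := by
  sorry

/-- **CLB `stub_conductanceLowerBound` — POSITIVITY OF THE DC LIMIT (OPEN; rev-5 stub replacing the seam SI):
`StaticAbelianSqueeze.ConductanceLowerBound` BY NAME** (item stmt-AtomisticToContinuum-11749, refuter-vetted; closing that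
item closes this stub by `exact`).  For `P` (all `> 0`), under weak-NESS uniqueness, for every steady-state family, `T > 0`
and response coefficients `D_N`: `∃ c > 0 ∃ N₁ ∀ N ≥ N₁, c ≤ D_N`.  NECESSARY for the crux at every `T` carrying an Abelian
witness (`lowerBound_of_crux`).  Used ONCE, along the canonical steady family, to make the common limit `L` positive. -/
theorem stub_conductanceLowerBound :
    Summit.AtomisticToContinuum.FouriersLaw.Theses.StaticAbelianSqueeze.ConductanceLowerBound := by
  sorry



/-! ## rev-4 stubs (M), A, B — CLOSED (tree theorems p127009, p126906, p126788) -/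

/-- **(M) `stub_fixedFrequencyMatching`** — CLOSED: the landed tree theorem (p127009; verbatim stmt-14013's registered stub;
assembly of (B′) uniform offset matching of engines + (C′) uniform anchored tails ⇒ fixed-time matching ⇒ dominated convergence). For `P` (all
`> 0`), `T > 0` with regular DLR uniqueness (inline; = S7, landed), every regular pair `(μT, D)` and every `ν > 0`:
`F_N(ν)/N → Â(ν) := ∫₀^∞ e^{-νt} C_T(t) dt`. -/
theorem stub_fixedFrequencyMatching :
    ∀ ω₂ lam β γ : ℝ, 0 < ω₂ → 0 < lam → 0 < β → 0 < γ → ∀ T : ℝ, 0 < T →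
      (∀ μ₁ μ₂ : MeasureTheory.Measure
            Literature.MathematicalPhysics.KineticTheory.HeatConduction.ChainConfig,
          (Literature.MathematicalPhysics.KineticTheory.HeatConduction.pinnedChain
                ω₂ lam β γ).IsChainGibbsMeasure T μ₁ →
          Literature.MathematicalPhysics.KineticTheory.HeatConduction.IsShiftInvariant μ₁ →
          (Literature.MathematicalPhysics.KineticTheory.HeatConduction.pinnedChain
                ω₂ lam β γ).HasSuperstabilityEstimate μ₁ →
          (Literature.MathematicalPhysics.KineticTheory.HeatConduction.pinnedChain
                ω₂ lam β γ).IsChainGibbsMeasure T μ₂ →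
          Literature.MathematicalPhysics.KineticTheory.HeatConduction.IsShiftInvariant μ₂ →
          (Literature.MathematicalPhysics.KineticTheory.HeatConduction.pinnedChain
                ω₂ lam β γ).HasSuperstabilityEstimate μ₂ → μ₁ = μ₂) →

      ∀ (μT : MeasureTheory.Measure
            Literature.MathematicalPhysics.KineticTheory.HeatConduction.ChainConfig)
        (D : Literature.MathematicalPhysics.KineticTheory.HeatConduction.InfiniteChainDynamics
          (Literature.MathematicalPhysics.KineticTheory.HeatConduction.pinnedChain ω₂ lam β γ)),
        (Literature.MathematicalPhysics.KineticTheory.HeatConduction.pinnedChain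
            ω₂ lam β γ).IsChainGibbsMeasure T μT →
        Literature.MathematicalPhysics.KineticTheory.HeatConduction.IsShiftInvariant μT →
        (Literature.MathematicalPhysics.KineticTheory.HeatConduction.pinnedChain
            ω₂ lam β γ).HasSuperstabilityEstimate μT →
        D.carrier ⊆ (Literature.MathematicalPhysics.KineticTheory.HeatConduction.pinnedChain
            ω₂ lam β γ).bmGood →
        D.PreservesMeasure μT →
        (∀ t : ℝ, D.HasAbsConvergentCorrelation μT t) →
        ∀ ν : ℝ, 0 < ν →
          Filter.Tendsto (fun N : ℕ =>
              MeasureTheory.integral (MeasureTheory.volume.restrict (Set.Ioi (0:ℝ))) (fun t : ℝ =>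
                Real.exp (-(ν * t)) *
                  ∫ z, (∑ i : Fin N, (Literature.MathematicalPhysics.KineticTheory.HeatConduction.pinnedChain
                          ω₂ lam β γ).bondCurrent N i z) *
                    (∫ y, (∑ i : Fin N, (Literature.MathematicalPhysics.KineticTheory.HeatConduction.pinnedChain
                          ω₂ lam β γ).bondCurrent N i y)
                      ∂((Literature.MathematicalPhysics.KineticTheory.HeatConduction.pinnedChain
                          ω₂ lam β γ).transitionKernel N T T t.toNNReal z))
                    ∂((Literature.MathematicalPhysics.KineticTheory.HeatConduction.pinnedChain
                          ω₂ lam β γ).gibbsMeasure N T)) / (N : ℝ))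
            Filter.atTop
            (nhds (MeasureTheory.integral (MeasureTheory.volume.restrict (Set.Ioi (0:ℝ)))
              (fun t : ℝ => Real.exp (-(ν * t)) * D.currentCorrelation μT t))) :=
  Summit.AtomisticToContinuum.FouriersLaw.Theorems.AbelThermodynamicLimit.LoomisCompactHorizonWitness.stub_fixedFrequencyMatching

/-- **A `stub_anchoredDcLimitOfRegularity`** — CLOSED: the landed tree theorem (p126906). THE ANCHORED DC VALUE CONVERGES, AND SO
DOES THE ABEL FUNCTION, from (R) + matching.
For `P` (all `> 0`), `T > 0`: IF (R) holds at `T` (verbatim the body of `UniformAbelianRegularity` at this point) and the scaled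
resolvent forms `F_N(ν)/N` converge at every `ν > 0` to some `Ahat ν`, THEN there is `L` with `A_N(0) → L` (`N → ∞`; `A_N(0)` =
`Σ_k ∫₀^∞ ⟨j_{c_N}(0) j_k(t)⟩_{N,T} dt`, junk `0` for `N < 2`) and `Ahat ν → L` (`ν ↓ 0`).  Proof plan: DC-flatness
`(N-1)·A_N(0) = ∫₀^∞ c_N` (`anchoredKubo_core_of_summedKubo` with `D := ∫₀^∞ c_N / ((N-1)T²)`, integrability of `c_N` on `(0,∞)`
from `integral_crossCorr_total_eq_integral_mul_kubo`), so (R) reads `|A_N(0) - F_N(ν)/(N-1)| ≤ εN/(N-1) ≤ 2ε` for `ν < ν₀(ε)`,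
`N ≥ N₀(ν)`; with `F_N(ν)/N → Ahat ν`: `limsup_N |A_N(0) - Ahat ν| ≤ 2ε`, hence `(A_N(0))_N` is Cauchy, converges to some `L`, and
`|Ahat ν - L| ≤ 2ε` on `(0, ν₀(ε))`. Size M. -/
theorem stub_anchoredDcLimitOfRegularity :
    ∀ ω₂ lam β γ : ℝ, 0 < ω₂ → 0 < lam → 0 < β → 0 < γ → ∀ T : ℝ, 0 < T →
      (∀ ε : ℝ, 0 < ε → ∃ ν₀ : ℝ, 0 < ν₀ ∧ ∀ ν : ℝ, 0 < ν → ν < ν₀ → ∃ N₀ : ℕ, ∀ N : ℕ, N₀ ≤ N →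
        |∫ t in Set.Ioi (0:ℝ), (1 - Real.exp (-(ν * t))) *
            ∫ z, (∑ i : Fin N, (Literature.MathematicalPhysics.KineticTheory.HeatConduction.pinnedChain
                    ω₂ lam β γ).bondCurrent N i z) *
              (∫ y, (∑ i : Fin N, (Literature.MathematicalPhysics.KineticTheory.HeatConduction.pinnedChain
                    ω₂ lam β γ).bondCurrent N i y)
                ∂((Literature.MathematicalPhysics.KineticTheory.HeatConduction.pinnedChain
                    ω₂ lam β γ).transitionKernel N T T t.toNNReal z))
              ∂((Literature.MathematicalPhysics.KineticTheory.HeatConduction.pinnedChain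
                    ω₂ lam β γ).gibbsMeasure N T)| ≤ ε * N) →
      ∀ Ahat : ℝ → ℝ,
        (∀ ν : ℝ, 0 < ν →
          Filter.Tendsto (fun N : ℕ =>
              MeasureTheory.integral (MeasureTheory.volume.restrict (Set.Ioi (0:ℝ))) (fun t : ℝ =>
                Real.exp (-(ν * t)) *
                  ∫ z, (∑ i : Fin N, (Literature.MathematicalPhysics.KineticTheory.HeatConduction.pinnedChain
                    ω₂ lam β γ).bondCurrent N i z) *
              (∫ y, (∑ i : Fin N, (Literature.MathematicalPhysics.KineticTheory.HeatConduction.pinnedChain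
                    ω₂ lam β γ).bondCurrent N i y)
                ∂((Literature.MathematicalPhysics.KineticTheory.HeatConduction.pinnedChain
                    ω₂ lam β γ).transitionKernel N T T t.toNNReal z))
              ∂((Literature.MathematicalPhysics.KineticTheory.HeatConduction.pinnedChain
                    ω₂ lam β γ).gibbsMeasure N T)) / (N : ℝ))
            Filter.atTop (nhds (Ahat ν))) →
        ∃ L : ℝ,
          Filter.Tendsto (fun N : ℕ =>
              if hN : 2 ≤ N then
                ∑ k : Fin N, ∫ t in Set.Ioi (0 : ℝ),
              ∫ z, (Literature.MathematicalPhysics.KineticTheory.HeatConduction.pinnedChain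
                      ω₂ lam β γ).bondCurrent N ⟨(N - 1) / 2, by omega⟩ z *
                (∫ y, (Literature.MathematicalPhysics.KineticTheory.HeatConduction.pinnedChain
                      ω₂ lam β γ).bondCurrent N k y
                  ∂((Literature.MathematicalPhysics.KineticTheory.HeatConduction.pinnedChain
                      ω₂ lam β γ).transitionKernel N T T t.toNNReal z))
              ∂((Literature.MathematicalPhysics.KineticTheory.HeatConduction.pinnedChain
                      ω₂ lam β γ).gibbsMeasure N T)
              else 0)
            Filter.atTop (nhds L) ∧
          Filter.Tendsto Ahat (nhdsWithin (0:ℝ) (Set.Ioi 0)) (nhds L) :=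
  Summit.AtomisticToContinuum.FouriersLaw.Theorems.AbelThermodynamicLimit.LoomisCompactHorizonWitness.stub_anchoredDcLimitOfRegularity

/-- **B `stub_anchoredPostDarkOfDcLimit`** — CLOSED: the landed tree theorem (p126788). ANCHORED POST-DARK STABILITY FROM THE
TWO LIMITS (the window scheme read backwards).
For `P` (all `> 0`), `T > 0`, a regular pair `(μT, D)` (DLR + shift-invariant + BM-superstable state, `D.carrier ⊆ bmGood`,
`μT`-preserving, absolutely convergent correlations) and `L : ℝ`: IF `A_N(0) → L` and `∫₀^∞ e^{-νt} C_T(t) dt → L` (`ν ↓ 0`), THEN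
`∀ ε > 0 ∃ τ₀ > 0 ∀ τ ≥ τ₀ ∃ N₀ ∀ N ≥ N₀ (N ≥ 2), |A_N(0) - W_N(τ)| ≤ ε`, `W_N(τ) = Σ_k ∫₀^τ (1-t/τ)² ⟨j_{c_N}(0) j_k(t)⟩_{N,T} dt`.
Proof plan: S2 `stub_witnessPositiveType` (bounded measurable `C_T`, `V ≥ 0`) + S1 `stub_karamataRieszTwo` give
`∫₀^τ (1-t/τ)² C_T → L`; S4 `stub_fixedHorizonMatching` (fed S7 `stub_regularDLRUnique`) gives `W_N(τ) → ∫₀^τ (1-t/τ)² C_T` for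
each `τ > 0`; then `ε/3`. Size M. -/
theorem stub_anchoredPostDarkOfDcLimit :
    ∀ ω₂ lam β γ : ℝ, 0 < ω₂ → 0 < lam → 0 < β → 0 < γ → ∀ T : ℝ, 0 < T →
      ∀ (μT : MeasureTheory.Measure
            Literature.MathematicalPhysics.KineticTheory.HeatConduction.ChainConfig)
        (D : Literature.MathematicalPhysics.KineticTheory.HeatConduction.InfiniteChainDynamics
          (Literature.MathematicalPhysics.KineticTheory.HeatConduction.pinnedChain ω₂ lam β γ)),
        (Literature.MathematicalPhysics.KineticTheory.HeatConduction.pinnedChain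
            ω₂ lam β γ).IsChainGibbsMeasure T μT →
        Literature.MathematicalPhysics.KineticTheory.HeatConduction.IsShiftInvariant μT →
        (Literature.MathematicalPhysics.KineticTheory.HeatConduction.pinnedChain
            ω₂ lam β γ).HasSuperstabilityEstimate μT →
        D.carrier ⊆ (Literature.MathematicalPhysics.KineticTheory.HeatConduction.pinnedChain
            ω₂ lam β γ).bmGood →
        D.PreservesMeasure μT →
        (∀ t : ℝ, D.HasAbsConvergentCorrelation μT t) →
        ∀ L : ℝ,
          Filter.Tendsto (fun N : ℕ =>
              if hN : 2 ≤ N then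
                ∑ k : Fin N, ∫ t in Set.Ioi (0 : ℝ),
              ∫ z, (Literature.MathematicalPhysics.KineticTheory.HeatConduction.pinnedChain
                      ω₂ lam β γ).bondCurrent N ⟨(N - 1) / 2, by omega⟩ z *
                (∫ y, (Literature.MathematicalPhysics.KineticTheory.HeatConduction.pinnedChain
                      ω₂ lam β γ).bondCurrent N k y
                  ∂((Literature.MathematicalPhysics.KineticTheory.HeatConduction.pinnedChain
                      ω₂ lam β γ).transitionKernel N T T t.toNNReal z))
              ∂((Literature.MathematicalPhysics.KineticTheory.HeatConduction.pinnedChain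
                      ω₂ lam β γ).gibbsMeasure N T)
              else 0)
            Filter.atTop (nhds L) →
          Filter.Tendsto (fun ν : ℝ =>
              MeasureTheory.integral (MeasureTheory.volume.restrict (Set.Ioi (0:ℝ)))
                (fun t : ℝ => Real.exp (-(ν * t)) * D.currentCorrelation μT t))
            (nhdsWithin (0:ℝ) (Set.Ioi 0)) (nhds L) →
          ∀ ε : ℝ, 0 < ε → ∃ τ₀ : ℝ, 0 < τ₀ ∧ ∀ τ : ℝ, τ₀ ≤ τ → ∃ N₀ : ℕ, ∀ (N : ℕ), N₀ ≤ N →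
            ∀ hN : 2 ≤ N,
              |(∑ k : Fin N, ∫ t in Set.Ioi (0 : ℝ),
              ∫ z, (Literature.MathematicalPhysics.KineticTheory.HeatConduction.pinnedChain
                      ω₂ lam β γ).bondCurrent N ⟨(N - 1) / 2, by omega⟩ z *
                (∫ y, (Literature.MathematicalPhysics.KineticTheory.HeatConduction.pinnedChain
                      ω₂ lam β γ).bondCurrent N k y
                  ∂((Literature.MathematicalPhysics.KineticTheory.HeatConduction.pinnedChain
                      ω₂ lam β γ).transitionKernel N T T t.toNNReal z))
              ∂((Literature.MathematicalPhysics.KineticTheory.HeatConduction.pinnedChain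
                      ω₂ lam β γ).gibbsMeasure N T)) -
                (∑ k : Fin N, ∫ t in Set.Ioc (0 : ℝ) τ, (1 - t / τ) ^ 2 *
              ∫ z, (Literature.MathematicalPhysics.KineticTheory.HeatConduction.pinnedChain
                      ω₂ lam β γ).bondCurrent N ⟨(N - 1) / 2, by omega⟩ z *
                (∫ y, (Literature.MathematicalPhysics.KineticTheory.HeatConduction.pinnedChain
                      ω₂ lam β γ).bondCurrent N k y
                  ∂((Literature.MathematicalPhysics.KineticTheory.HeatConduction.pinnedChain
                      ω₂ lam β γ).transitionKernel N T T t.toNNReal z))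
              ∂((Literature.MathematicalPhysics.KineticTheory.HeatConduction.pinnedChain
                      ω₂ lam β γ).gibbsMeasure N T))| ≤ ε :=
  Summit.AtomisticToContinuum.FouriersLaw.Theorems.AbelThermodynamicLimit.LoomisCompactHorizonWitness.stub_anchoredPostDarkOfDcLimit

/-! ## The leaves of S3, S4 (LANDED); signatures self-contained over tree declarations -/

/-- **Leaf of S3 — `stub_uniformMixing`: δ-UNIFORM EXPONENTIAL MIXING of the two-temperature
semigroups near equilibrium** (infrastructure; TRUE — Cuneo–Eckmann–Hairer–Rey-Bellet 2018 Thm 2.13 /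
eq. (2.5) with the Harris constants tracked uniformly for bath temperatures `(T+δ/2, T-δ/2)`, `|δ| < δ₀`;
size XL: the tree proves (2.5) at FIXED temperatures (`thm213_holds`, LangevinChainHarris pipeline) — the
uniformity of the Lyapunov constant (H2), of the minorisation constants on the sublevel sets and hence of
`(Cm, c)` over a compact set of temperature pairs is the content). For `P` (all `> 0`), `T > 0`, `N ≥ 2`:
there are `δ₀ ∈ (0, 2T)`, a weight exponent `ϑ ∈ (0, 1/(T+δ₀/2))` and constants `Cm ≥ 0`, `c > 0` such that
for every `|δ| < δ₀`, every invariant probability measure `ν` of the kernels `transitionKernel N (T+δ/2) (T-δ/2)`,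
every `z`, `t` and continuous `f` with `|f| ≤ e^{ϑH}`: `|P^δ_t f(z) - ν(f)| ≤ Cm e^{ϑ H(z)} e^{-ct}`. With it the
landed `stub_anchoredKuboOfUniformMixing` (p93721) gives S3. Alternative closers of S3 (landed p93353):
items stmt-9144 ∧ stmt-9146 (`stub_anchoredKuboOfResponseDensity`) or stmt-13419
(`anchoredKubo_of_kuboAbelIdentity`). -/
theorem stub_uniformMixing :
    ∀ ω₂ lam β γ : ℝ, 0 < ω₂ → 0 < lam → 0 < β → 0 < γ → ∀ T : ℝ, 0 < T →
      ∀ (N : ℕ), 2 ≤ N →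
          ∃ δ₀ ϑ Cm c : ℝ, 0 < δ₀ ∧ δ₀ < 2 * T ∧ 0 < ϑ ∧ ϑ < 1 / (T + δ₀ / 2) ∧ 0 ≤ Cm ∧ 0 < c ∧
            ∀ δ : ℝ, |δ| < δ₀ → ∀ ν : MeasureTheory.Measure (Literature.MathematicalPhysics.KineticTheory.HeatConduction.PhaseSpace N),
              MeasureTheory.IsProbabilityMeasure ν →
              (∀ t : NNReal, ν.bind ((Literature.MathematicalPhysics.KineticTheory.HeatConduction.pinnedChain ω₂ lam β γ).transitionKernel N (T + δ / 2) (T - δ / 2) t) = ν) →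
              ∀ (z : Literature.MathematicalPhysics.KineticTheory.HeatConduction.PhaseSpace N) (t : NNReal) (f : Literature.MathematicalPhysics.KineticTheory.HeatConduction.PhaseSpace N → ℝ), Continuous f →
                (∀ y, |f y| ≤ Real.exp (ϑ * (Literature.MathematicalPhysics.KineticTheory.HeatConduction.pinnedChain ω₂ lam β γ).hamiltonian N y)) →
                |(∫ y, f y ∂((Literature.MathematicalPhysics.KineticTheory.HeatConduction.pinnedChain ω₂ lam β γ).transitionKernel N (T + δ / 2) (T - δ / 2) t z)) -
                    ∫ y, f y ∂ν| ≤
                  Cm * Real.exp (ϑ * (Literature.MathematicalPhysics.KineticTheory.HeatConduction.pinnedChain ω₂ lam β γ).hamiltonian N z) * Real.exp (-c * t) :=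
  Summit.AtomisticToContinuum.FouriersLaw.Theorems.AbelThermodynamicLimit.LoomisCompactHorizonWitness.stub_uniformMixing

/-- **Leaf (C) of S4 — `stub_anchoredCorrelationTails`: `N`-UNIFORM ANCHORED CORRELATION TAILS = the light
cone of the OPEN chain at FIXED time** (registered by the S4 worker; size L–XL; TRUE: finite speed of
propagation in `L²(μ_{N,T})` for the thermostatted chain, uniformly in `N` on `t ∈ [0, τ]`; no static
clustering needed since `j_{c_N}` has zero conditional mean given the positions). For every `τ > 0`, `ε > 0`
there are `R`, `N₀` with `Σ_{|k - c_N| > R} |⟨j_{c_N}(0) j_k(t)⟩_{N,T}| ≤ ε` for all `N ≥ N₀`, `t ∈ [0, τ]`.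
Implied by stmt-14013's anchor-uniform (C′) `stub_uniformAnchoredCorrelationTails`
(`stub_anchoredCorrelationTailsOfUniform`, landed there). -/
theorem stub_anchoredCorrelationTails :
    ∀ ω₂ lam β γ : ℝ, 0 < ω₂ → 0 < lam → 0 < β → 0 < γ → ∀ T : ℝ, 0 < T →
      ∀ τ : ℝ, 0 < τ → ∀ ε : ℝ, 0 < ε → ∃ R : ℕ, ∃ N₀ : ℕ, ∀ N : ℕ, N₀ ≤ N → ∀ hN : 2 ≤ N,
        ∀ t ∈ Set.Icc (0 : ℝ) τ,
          (∑ k : Fin N, if (N - 1) / 2 ≤ k.val + R ∧ k.val ≤ (N - 1) / 2 + R then (0 : ℝ) else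
            |∫ z, (Literature.MathematicalPhysics.KineticTheory.HeatConduction.pinnedChain
                      ω₂ lam β γ).bondCurrent N ⟨(N - 1) / 2, by omega⟩ z *
                (∫ y, (Literature.MathematicalPhysics.KineticTheory.HeatConduction.pinnedChain
                      ω₂ lam β γ).bondCurrent N k y
                  ∂((Literature.MathematicalPhysics.KineticTheory.HeatConduction.pinnedChain
                      ω₂ lam β γ).transitionKernel N T T t.toNNReal z))
              ∂((Literature.MathematicalPhysics.KineticTheory.HeatConduction.pinnedChain
                      ω₂ lam β γ).gibbsMeasure N T)|) ≤ ε :=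
  Summit.AtomisticToContinuum.FouriersLaw.Theorems.AbelThermodynamicLimit.LoomisCompactHorizonWitness.stub_anchoredCorrelationTails

/-- **Leaf (B₀) of S4 — `stub_fixedTimeOffsetMatching`: PER-OFFSET FIXED-TIME TWO-DYNAMICS MATCHING**
(registered by the S4 worker; size XL; TRUE under its inline regular-uniqueness hypothesis, now a theorem:
S7). For a regular pair `(μT, D)` and every offset `x ∈ ℤ`, `t > 0`:
`⟨j_{c_N}(0) j_{c_N + x}(t)⟩_{N,T} → ∫ j_0 (j_x ∘ φ_t) dμT` as `N → ∞` — coupling of the open `N`-chain kernels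
with the Buttà–Marchioro flow on the central window (two-dynamics light cone at fixed time) + convergence
of the central-window laws of the free-boundary Gibbs measure `gibbsMeasure N T` to the unique regular
(= unique one-site-tight, `tightDLRUnique`) DLR state (1-D equivalence of ensembles; the tree now has the
transfer-operator machinery: `InfiniteChainGibbsUniqueness`, `InfiniteChainTransferBridge`,
`chainSpecification_Icc_tendsto_uniformly`). Implied by stmt-14013's anchor-uniform (B′). -/
theorem stub_fixedTimeOffsetMatching :
    ∀ ω₂ lam β γ : ℝ, 0 < ω₂ → 0 < lam → 0 < β → 0 < γ → ∀ T : ℝ, 0 < T →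
      (∀ μ₁ μ₂ : MeasureTheory.Measure
            Literature.MathematicalPhysics.KineticTheory.HeatConduction.ChainConfig,
          (Literature.MathematicalPhysics.KineticTheory.HeatConduction.pinnedChain
                ω₂ lam β γ).IsChainGibbsMeasure T μ₁ →
          Literature.MathematicalPhysics.KineticTheory.HeatConduction.IsShiftInvariant μ₁ →
          (Literature.MathematicalPhysics.KineticTheory.HeatConduction.pinnedChain
                ω₂ lam β γ).HasSuperstabilityEstimate μ₁ →
          (Literature.MathematicalPhysics.KineticTheory.HeatConduction.pinnedChain
                ω₂ lam β γ).IsChainGibbsMeasure T μ₂ →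
          Literature.MathematicalPhysics.KineticTheory.HeatConduction.IsShiftInvariant μ₂ →
          (Literature.MathematicalPhysics.KineticTheory.HeatConduction.pinnedChain
                ω₂ lam β γ).HasSuperstabilityEstimate μ₂ → μ₁ = μ₂) →
      ∀ (μT : MeasureTheory.Measure
            Literature.MathematicalPhysics.KineticTheory.HeatConduction.ChainConfig)
        (D : Literature.MathematicalPhysics.KineticTheory.HeatConduction.InfiniteChainDynamics
          (Literature.MathematicalPhysics.KineticTheory.HeatConduction.pinnedChain ω₂ lam β γ)),
        (Literature.MathematicalPhysics.KineticTheory.HeatConduction.pinnedChain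
            ω₂ lam β γ).IsChainGibbsMeasure T μT →
        Literature.MathematicalPhysics.KineticTheory.HeatConduction.IsShiftInvariant μT →
        (Literature.MathematicalPhysics.KineticTheory.HeatConduction.pinnedChain
            ω₂ lam β γ).HasSuperstabilityEstimate μT →
        D.carrier ⊆ (Literature.MathematicalPhysics.KineticTheory.HeatConduction.pinnedChain
            ω₂ lam β γ).bmGood →
        D.PreservesMeasure μT →
        (∀ t : ℝ, D.HasAbsConvergentCorrelation μT t) →
        ∀ (x : ℤ) (t : ℝ), 0 < t →
          Filter.Tendsto (fun N : ℕ =>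
              if hN : 2 * x.natAbs + 2 ≤ N then
                ∫ z, (Literature.MathematicalPhysics.KineticTheory.HeatConduction.pinnedChain
                        ω₂ lam β γ).bondCurrent N ⟨(N - 1) / 2, by omega⟩ z *
                  (∫ y, (Literature.MathematicalPhysics.KineticTheory.HeatConduction.pinnedChain
                        ω₂ lam β γ).bondCurrent N ⟨((((N - 1) / 2 : ℕ) : ℤ) + x).toNat, by omega⟩ y
                    ∂((Literature.MathematicalPhysics.KineticTheory.HeatConduction.pinnedChain
                        ω₂ lam β γ).transitionKernel N T T t.toNNReal z))
                  ∂((Literature.MathematicalPhysics.KineticTheory.HeatConduction.pinnedChain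
                        ω₂ lam β γ).gibbsMeasure N T)
              else 0)
            Filter.atTop
            (nhds (∫ σ, (Literature.MathematicalPhysics.KineticTheory.HeatConduction.pinnedChain
                      ω₂ lam β γ).bondCurrentZ σ 0 *
              (Literature.MathematicalPhysics.KineticTheory.HeatConduction.pinnedChain
                      ω₂ lam β γ).bondCurrentZ (D.flow t σ) x ∂μT)) :=
  Summit.AtomisticToContinuum.FouriersLaw.Theorems.AbelThermodynamicLimit.LoomisCompactHorizonWitness.stub_fixedTimeOffsetMatching

/-! ## The seven rev-1 stubs: three CLOSED (tree theorems), three DERIVED from the leaves, S5 open -/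

/-- **S1 `stub_karamataRieszTwo`** — CLOSED: the landed tree theorem (p87844), Hardy–Littlewood–Karamata
index 2 in Riesz-window form (Literature `karamata_tauberian_laplace_two`). -/
theorem stub_karamataRieszTwo :
    ∀ (C : ℝ → ℝ) (L M : ℝ), Measurable C → (∀ t : ℝ, |C t| ≤ M) →
      (∀ t : ℝ, 0 ≤ t → 0 ≤ ∫ u in Set.Ioc (0 : ℝ) t, (t - u) * C u) →
      Filter.Tendsto (fun ν : ℝ => ∫ t in Set.Ioi (0 : ℝ), Real.exp (-(ν * t)) * C t)
        (nhdsWithin (0 : ℝ) (Set.Ioi 0)) (nhds L) →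
      Filter.Tendsto (fun τ : ℝ => ∫ t in Set.Ioc (0 : ℝ) τ, (1 - t / τ) ^ 2 * C t)
        Filter.atTop (nhds L) :=
  Summit.AtomisticToContinuum.FouriersLaw.Theorems.AbelThermodynamicLimit.LoomisCompactHorizonWitness.stub_karamataRieszTwo

/-- **S2 `stub_witnessPositiveType`** — CLOSED: the landed tree theorem (p91227), positive type /
boundedness / measurability of the regular witness's current autocorrelation
(Literature `InfiniteChainCurrentPositiveType`). -/
theorem stub_witnessPositiveType :
    ∀ ω₂ lam β γ : ℝ, 0 < ω₂ → 0 < lam → 0 < β → 0 < γ → ∀ T : ℝ, 0 < T →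
      ∀ (μT : MeasureTheory.Measure
            Literature.MathematicalPhysics.KineticTheory.HeatConduction.ChainConfig)
        (D : Literature.MathematicalPhysics.KineticTheory.HeatConduction.InfiniteChainDynamics
          (Literature.MathematicalPhysics.KineticTheory.HeatConduction.pinnedChain ω₂ lam β γ)),
        (Literature.MathematicalPhysics.KineticTheory.HeatConduction.pinnedChain
            ω₂ lam β γ).IsChainGibbsMeasure T μT →
        Literature.MathematicalPhysics.KineticTheory.HeatConduction.IsShiftInvariant μT →
        (Literature.MathematicalPhysics.KineticTheory.HeatConduction.pinnedChain
            ω₂ lam β γ).HasSuperstabilityEstimate μT →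
        D.carrier ⊆ (Literature.MathematicalPhysics.KineticTheory.HeatConduction.pinnedChain
            ω₂ lam β γ).bmGood →
        D.PreservesMeasure μT →
        (∀ t : ℝ, D.HasAbsConvergentCorrelation μT t) →
        Measurable (D.currentCorrelation μT) ∧
        (∃ M : ℝ, ∀ t : ℝ, |D.currentCorrelation μT t| ≤ M) ∧
        ∀ t : ℝ, 0 ≤ t →
          0 ≤ ∫ u in Set.Ioc (0 : ℝ) t, (t - u) * D.currentCorrelation μT u :=
  Summit.AtomisticToContinuum.FouriersLaw.Theorems.AbelThermodynamicLimit.LoomisCompactHorizonWitness.stub_witnessPositiveType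

/-- **S7 `stub_regularDLRUnique`** — CLOSED: the landed tree theorem (p104271), DLR uniqueness in the
regular class (one-site-tight DLR states are unique, Literature `InfiniteChainGibbsUniqueness`). -/
theorem stub_regularDLRUnique :
    ∀ ω₂ lam β γ : ℝ, 0 < ω₂ → 0 < lam → 0 < β → 0 < γ →
      ∀ T : ℝ, 0 < T →
        ∀ μ₁ μ₂ : MeasureTheory.Measure
            Literature.MathematicalPhysics.KineticTheory.HeatConduction.ChainConfig,
          (Literature.MathematicalPhysics.KineticTheory.HeatConduction.pinnedChain
                ω₂ lam β γ).IsChainGibbsMeasure T μ₁ →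
          Literature.MathematicalPhysics.KineticTheory.HeatConduction.IsShiftInvariant μ₁ →
          (Literature.MathematicalPhysics.KineticTheory.HeatConduction.pinnedChain
                ω₂ lam β γ).HasSuperstabilityEstimate μ₁ →
          (Literature.MathematicalPhysics.KineticTheory.HeatConduction.pinnedChain
                ω₂ lam β γ).IsChainGibbsMeasure T μ₂ →
          Literature.MathematicalPhysics.KineticTheory.HeatConduction.IsShiftInvariant μ₂ →
          (Literature.MathematicalPhysics.KineticTheory.HeatConduction.pinnedChain
                ω₂ lam β γ).HasSuperstabilityEstimate μ₂ → μ₁ = μ₂ :=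
  Summit.AtomisticToContinuum.FouriersLaw.Theorems.AbelThermodynamicLimit.LoomisCompactHorizonWitness.stub_regularDLRUnique

/-- **S3 `stub_anchoredKubo`** — DERIVED from the leaf `stub_uniformMixing` by the landed
`stub_anchoredKuboOfUniformMixing` (p93721): anchored open-chain Kubo formula at fixed `N`,
`T² D_N = Σ_k ∫₀^∞ ⟨j_{c_N}(0) j_k(t)⟩_{N,T} dt` with integrable pair correlations (Kundu–Dhar–Narayan; the only
place where `γ > 0` and `Uniq` act). -/
theorem stub_anchoredKubo :
    ∀ ω₂ lam β γ : ℝ, 0 < ω₂ → 0 < lam → 0 < β → 0 < γ →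
      (∀ (N : ℕ) (T_L T_R : ℝ), 0 < T_L → 0 < T_R →
        ∀ μ ν : MeasureTheory.Measure
            (Literature.MathematicalPhysics.KineticTheory.HeatConduction.PhaseSpace N),
          (Literature.MathematicalPhysics.KineticTheory.HeatConduction.pinnedChain
              ω₂ lam β γ).IsSteadyState N T_L T_R μ →
          (Literature.MathematicalPhysics.KineticTheory.HeatConduction.pinnedChain
              ω₂ lam β γ).IsSteadyState N T_L T_R ν → μ = ν) →
      ∀ T : ℝ, 0 < T →
      ∀ (μ : (N : ℕ) → ℝ → ℝ → MeasureTheory.Measure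
            (Literature.MathematicalPhysics.KineticTheory.HeatConduction.PhaseSpace N))
        (Dn : ℕ → ℝ),
        (∀ (N : ℕ) (T_L T_R : ℝ), 0 < T_L → 0 < T_R →
          (Literature.MathematicalPhysics.KineticTheory.HeatConduction.pinnedChain
              ω₂ lam β γ).IsSteadyState N T_L T_R (μ N T_L T_R)) →
        (∀ N : ℕ, Filter.Tendsto (fun δ : ℝ =>
            (Literature.MathematicalPhysics.KineticTheory.HeatConduction.pinnedChain
                ω₂ lam β γ).totalCurrent (μ N (T + δ / 2) (T - δ / 2)) / δ)
          (nhdsWithin 0 {(0 : ℝ)}ᶜ) (nhds (Dn N))) →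
        ∀ (N : ℕ) (hN : 2 ≤ N),
          (∀ i k : Fin N, MeasureTheory.IntegrableOn (fun t : ℝ =>
              ∫ z, (Literature.MathematicalPhysics.KineticTheory.HeatConduction.pinnedChain
                      ω₂ lam β γ).bondCurrent N i z *
                (∫ y, (Literature.MathematicalPhysics.KineticTheory.HeatConduction.pinnedChain
                      ω₂ lam β γ).bondCurrent N k y
                  ∂((Literature.MathematicalPhysics.KineticTheory.HeatConduction.pinnedChain
                      ω₂ lam β γ).transitionKernel N T T t.toNNReal z))
              ∂((Literature.MathematicalPhysics.KineticTheory.HeatConduction.pinnedChain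
                      ω₂ lam β γ).gibbsMeasure N T)) (Set.Ioi 0)) ∧
          T ^ 2 * Dn N = ∑ k : Fin N, ∫ t in Set.Ioi (0 : ℝ),
              ∫ z, (Literature.MathematicalPhysics.KineticTheory.HeatConduction.pinnedChain
                      ω₂ lam β γ).bondCurrent N ⟨(N - 1) / 2, by omega⟩ z *
                (∫ y, (Literature.MathematicalPhysics.KineticTheory.HeatConduction.pinnedChain
                      ω₂ lam β γ).bondCurrent N k y
                  ∂((Literature.MathematicalPhysics.KineticTheory.HeatConduction.pinnedChain
                      ω₂ lam β γ).transitionKernel N T T t.toNNReal z))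
              ∂((Literature.MathematicalPhysics.KineticTheory.HeatConduction.pinnedChain
                      ω₂ lam β γ).gibbsMeasure N T) := by
  intro ω₂ lam β γ hω hl hβ hγ hU T hT μ Dn hμ hDn N hN
  exact Summit.AtomisticToContinuum.FouriersLaw.Theorems.AbelThermodynamicLimit.LoomisCompactHorizonWitness.stub_anchoredKuboOfUniformMixing ω₂ lam β γ hω hl hβ hγ hU T hT μ Dn hμ hDn N hN
    (stub_uniformMixing ω₂ lam β γ hω hl hβ hγ T hT N hN)

/-- **S4 `stub_fixedHorizonMatching`** — DERIVED from the leaves (C) `stub_anchoredCorrelationTails` and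
(B₀) `stub_fixedTimeOffsetMatching` by the landed `stub_fixedHorizonMatchingOfDynamicalLeaves` (p95337):
open/closed matching of the anchored order-2 Riesz functional at FIXED horizon for regular witnesses. -/
theorem stub_fixedHorizonMatching :
    ∀ ω₂ lam β γ : ℝ, 0 < ω₂ → 0 < lam → 0 < β → 0 < γ → ∀ T : ℝ, 0 < T →
      (∀ μ₁ μ₂ : MeasureTheory.Measure
            Literature.MathematicalPhysics.KineticTheory.HeatConduction.ChainConfig,
          (Literature.MathematicalPhysics.KineticTheory.HeatConduction.pinnedChain
                ω₂ lam β γ).IsChainGibbsMeasure T μ₁ →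
          Literature.MathematicalPhysics.KineticTheory.HeatConduction.IsShiftInvariant μ₁ →
          (Literature.MathematicalPhysics.KineticTheory.HeatConduction.pinnedChain
                ω₂ lam β γ).HasSuperstabilityEstimate μ₁ →
          (Literature.MathematicalPhysics.KineticTheory.HeatConduction.pinnedChain
                ω₂ lam β γ).IsChainGibbsMeasure T μ₂ →
          Literature.MathematicalPhysics.KineticTheory.HeatConduction.IsShiftInvariant μ₂ →
          (Literature.MathematicalPhysics.KineticTheory.HeatConduction.pinnedChain
                ω₂ lam β γ).HasSuperstabilityEstimate μ₂ → μ₁ = μ₂) →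
      ∀ (μT : MeasureTheory.Measure
            Literature.MathematicalPhysics.KineticTheory.HeatConduction.ChainConfig)
        (D : Literature.MathematicalPhysics.KineticTheory.HeatConduction.InfiniteChainDynamics
          (Literature.MathematicalPhysics.KineticTheory.HeatConduction.pinnedChain ω₂ lam β γ)),
        (Literature.MathematicalPhysics.KineticTheory.HeatConduction.pinnedChain
            ω₂ lam β γ).IsChainGibbsMeasure T μT →
        Literature.MathematicalPhysics.KineticTheory.HeatConduction.IsShiftInvariant μT →
        (Literature.MathematicalPhysics.KineticTheory.HeatConduction.pinnedChain
            ω₂ lam β γ).HasSuperstabilityEstimate μT →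
        D.carrier ⊆ (Literature.MathematicalPhysics.KineticTheory.HeatConduction.pinnedChain
            ω₂ lam β γ).bmGood →
        D.PreservesMeasure μT →
        (∀ t : ℝ, D.HasAbsConvergentCorrelation μT t) →
        ∀ τ : ℝ, 0 < τ →
          Filter.Tendsto (fun N : ℕ =>
              if hN : 2 ≤ N then
                ∑ k : Fin N, ∫ t in Set.Ioc (0 : ℝ) τ, (1 - t / τ) ^ 2 *
                  ∫ z, (Literature.MathematicalPhysics.KineticTheory.HeatConduction.pinnedChain
                          ω₂ lam β γ).bondCurrent N ⟨(N - 1) / 2, by omega⟩ z *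
                    (∫ y, (Literature.MathematicalPhysics.KineticTheory.HeatConduction.pinnedChain
                          ω₂ lam β γ).bondCurrent N k y
                      ∂((Literature.MathematicalPhysics.KineticTheory.HeatConduction.pinnedChain
                          ω₂ lam β γ).transitionKernel N T T t.toNNReal z))
                  ∂((Literature.MathematicalPhysics.KineticTheory.HeatConduction.pinnedChain
                          ω₂ lam β γ).gibbsMeasure N T)
              else 0)
            Filter.atTop
            (nhds (∫ t in Set.Ioc (0 : ℝ) τ, (1 - t / τ) ^ 2 * D.currentCorrelation μT t)) := by
  intro ω₂ lam β γ hω hl hβ hγ T hT hU μT D hG hS hss hcar hP hAC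
  exact Summit.AtomisticToContinuum.FouriersLaw.Theorems.AbelThermodynamicLimit.LoomisCompactHorizonWitness.stub_fixedHorizonMatchingOfDynamicalLeaves ω₂ lam β γ hω hl hβ hγ T hT
    (stub_anchoredCorrelationTails ω₂ lam β γ hω hl hβ hγ T hT) hU μT D hG hS hss hcar hP hAC
    (stub_fixedTimeOffsetMatching ω₂ lam β γ hω hl hβ hγ T hT hU μT D hG hS hss hcar hP hAC)

/-! ## S5u, S5l, S5 — the line's rev-3 residual, DERIVED from (R) alone (via (M), A, B on the unconditional regular pair) -/

/-- The UNCONDITIONAL regular pair at `T`: the Buttà–Marchioro flow on `bmGood` and the transfer-operator state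
(`stub_heatableInfrastructure`, landed), with superstability from tightness (`InfiniteChainTightRegular`). -/
theorem exists_regularPair (ω₂ lam β γ : ℝ) (hω : 0 < ω₂) (hl : 0 < lam) (hβ : 0 < β) (hγ : 0 < γ)
    (T : ℝ) (hT : 0 < T) :
    ∃ (μT : Measure ChainConfig) (D : InfiniteChainDynamics (pinnedChain ω₂ lam β γ)),
      (pinnedChain ω₂ lam β γ).IsChainGibbsMeasure T μT ∧ IsShiftInvariant μT ∧
      (pinnedChain ω₂ lam β γ).HasSuperstabilityEstimate μT ∧ D.carrier ⊆ (pinnedChain ω₂ lam β γ).bmGood ∧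
      D.PreservesMeasure μT ∧ (∀ t : ℝ, D.HasAbsConvergentCorrelation μT t) := by
  obtain ⟨D, hcar, hfam⟩ :=
    Summit.AtomisticToContinuum.FouriersLaw.Theorems.GreenKuboContinuation.HeatedMeasureThermalExponent.stub_heatableInfrastructure
      ω₂ lam β γ hω hl hβ hγ
  obtain ⟨μT, hG, hS, hP, hAC, -, -⟩ := hfam T hT
  haveI : IsProbabilityMeasure μT := hG.isProbabilityMeasure
  obtain ⟨-, hss⟩ :=
    OscillatorChain.isShiftInvariant_and_hasSuperstabilityEstimate_of_tight_pinnedChain γ hω hl.le hβ.le hT hG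
      (oneSiteTight_of_isShiftInvariant hS)
  exact ⟨μT, D, hG, hS, hss, hcar.subset, hP, hAC⟩

/-- **S5 `stub_anchoredPostDarkStability`** (rev-3 residual, both halves at once, with `|·|`) — DERIVED from (R) ALONE
((M), A, B landed): take the unconditional regular pair, (M) fed S7, A fed (R), then B.  The crux's witness hypothesis
is not used. -/
theorem stub_anchoredPostDarkStability :
    ∀ ω₂ lam β γ : ℝ, 0 < ω₂ → 0 < lam → 0 < β → 0 < γ → ∀ T : ℝ, 0 < T →
      (∃ (μT : MeasureTheory.Measure
              Literature.MathematicalPhysics.KineticTheory.HeatConduction.ChainConfig)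
          (D : Literature.MathematicalPhysics.KineticTheory.HeatConduction.InfiniteChainDynamics
            (Literature.MathematicalPhysics.KineticTheory.HeatConduction.pinnedChain ω₂ lam β γ))
          (κ : ℝ),
          (Literature.MathematicalPhysics.KineticTheory.HeatConduction.pinnedChain
              ω₂ lam β γ).IsChainGibbsMeasure T μT ∧ D.PreservesMeasure μT ∧
          (∀ t : ℝ, D.HasAbsConvergentCorrelation μT t) ∧ 0 < κ ∧
          Filter.Tendsto (fun ν : ℝ => (T ^ 2)⁻¹ *
            MeasureTheory.integral (MeasureTheory.volume.restrict (Set.Ioi (0:ℝ)))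
              (fun t : ℝ => Real.exp (-(ν * t)) * D.currentCorrelation μT t))
            (nhdsWithin (0:ℝ) (Set.Ioi 0)) (nhds κ)) →
      ∀ ε : ℝ, 0 < ε → ∃ τ₀ : ℝ, 0 < τ₀ ∧ ∀ τ : ℝ, τ₀ ≤ τ → ∃ N₀ : ℕ, ∀ (N : ℕ), N₀ ≤ N →
        ∀ hN : 2 ≤ N,
          |(∑ k : Fin N, ∫ t in Set.Ioi (0 : ℝ),
              ∫ z, (Literature.MathematicalPhysics.KineticTheory.HeatConduction.pinnedChain
                      ω₂ lam β γ).bondCurrent N ⟨(N - 1) / 2, by omega⟩ z *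
                (∫ y, (Literature.MathematicalPhysics.KineticTheory.HeatConduction.pinnedChain
                      ω₂ lam β γ).bondCurrent N k y
                  ∂((Literature.MathematicalPhysics.KineticTheory.HeatConduction.pinnedChain
                      ω₂ lam β γ).transitionKernel N T T t.toNNReal z))
              ∂((Literature.MathematicalPhysics.KineticTheory.HeatConduction.pinnedChain
                      ω₂ lam β γ).gibbsMeasure N T)) -
            (∑ k : Fin N, ∫ t in Set.Ioc (0 : ℝ) τ, (1 - t / τ) ^ 2 *
              ∫ z, (Literature.MathematicalPhysics.KineticTheory.HeatConduction.pinnedChain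
                      ω₂ lam β γ).bondCurrent N ⟨(N - 1) / 2, by omega⟩ z *
                (∫ y, (Literature.MathematicalPhysics.KineticTheory.HeatConduction.pinnedChain
                      ω₂ lam β γ).bondCurrent N k y
                  ∂((Literature.MathematicalPhysics.KineticTheory.HeatConduction.pinnedChain
                      ω₂ lam β γ).transitionKernel N T T t.toNNReal z))
              ∂((Literature.MathematicalPhysics.KineticTheory.HeatConduction.pinnedChain
                      ω₂ lam β γ).gibbsMeasure N T))| ≤ ε := by
  intro ω₂ lam β γ hω hl hβ hγ T hT _hwit
  obtain ⟨μT, D, hG, hS, hss, hcar, hP, hAC⟩ := exists_regularPair ω₂ lam β γ hω hl hβ hγ T hT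
  have hM := stub_fixedFrequencyMatching ω₂ lam β γ hω hl hβ hγ T hT
    (stub_regularDLRUnique ω₂ lam β γ hω hl hβ hγ T hT) μT D hG hS hss hcar hP hAC
  obtain ⟨L, hA, hL⟩ := stub_anchoredDcLimitOfRegularity ω₂ lam β γ hω hl hβ hγ T hT
    (stub_uniformAbelianRegularity ω₂ lam β γ hω hl hβ hγ T hT) _ hM
  exact stub_anchoredPostDarkOfDcLimit ω₂ lam β γ hω hl hβ hγ T hT μT D hG hS hss hcar hP hAC L hA hL

/-- **S5u `stub_anchoredPostDarkUpper`** (rev-3 registered half; verbatim) — DERIVED: the upper side of S5. -/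
theorem stub_anchoredPostDarkUpper :
    ∀ ω₂ lam β γ : ℝ, 0 < ω₂ → 0 < lam → 0 < β → 0 < γ → ∀ T : ℝ, 0 < T →
      (∃ (μT : MeasureTheory.Measure
              Literature.MathematicalPhysics.KineticTheory.HeatConduction.ChainConfig)
          (D : Literature.MathematicalPhysics.KineticTheory.HeatConduction.InfiniteChainDynamics
            (Literature.MathematicalPhysics.KineticTheory.HeatConduction.pinnedChain ω₂ lam β γ))
          (κ : ℝ),
          (Literature.MathematicalPhysics.KineticTheory.HeatConduction.pinnedChain
              ω₂ lam β γ).IsChainGibbsMeasure T μT ∧ D.PreservesMeasure μT ∧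
          (∀ t : ℝ, D.HasAbsConvergentCorrelation μT t) ∧ 0 < κ ∧
          Filter.Tendsto (fun ν : ℝ => (T ^ 2)⁻¹ *
            MeasureTheory.integral (MeasureTheory.volume.restrict (Set.Ioi (0:ℝ)))
              (fun t : ℝ => Real.exp (-(ν * t)) * D.currentCorrelation μT t))
            (nhdsWithin (0:ℝ) (Set.Ioi 0)) (nhds κ)) →
      ∀ ε : ℝ, 0 < ε → ∃ τ₀ : ℝ, 0 < τ₀ ∧ ∀ τ : ℝ, τ₀ ≤ τ → ∃ N₀ : ℕ, ∀ (N : ℕ), N₀ ≤ N →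
        ∀ hN : 2 ≤ N,
          (∑ k : Fin N, ∫ t in Set.Ioi (0 : ℝ),
              ∫ z, (Literature.MathematicalPhysics.KineticTheory.HeatConduction.pinnedChain
                      ω₂ lam β γ).bondCurrent N ⟨(N - 1) / 2, by omega⟩ z *
                (∫ y, (Literature.MathematicalPhysics.KineticTheory.HeatConduction.pinnedChain
                      ω₂ lam β γ).bondCurrent N k y
                  ∂((Literature.MathematicalPhysics.KineticTheory.HeatConduction.pinnedChain
                      ω₂ lam β γ).transitionKernel N T T t.toNNReal z))
              ∂((Literature.MathematicalPhysics.KineticTheory.HeatConduction.pinnedChain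
                      ω₂ lam β γ).gibbsMeasure N T)) -
            (∑ k : Fin N, ∫ t in Set.Ioc (0 : ℝ) τ, (1 - t / τ) ^ 2 *
              ∫ z, (Literature.MathematicalPhysics.KineticTheory.HeatConduction.pinnedChain
                      ω₂ lam β γ).bondCurrent N ⟨(N - 1) / 2, by omega⟩ z *
                (∫ y, (Literature.MathematicalPhysics.KineticTheory.HeatConduction.pinnedChain
                      ω₂ lam β γ).bondCurrent N k y
                  ∂((Literature.MathematicalPhysics.KineticTheory.HeatConduction.pinnedChain
                      ω₂ lam β γ).transitionKernel N T T t.toNNReal z))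
              ∂((Literature.MathematicalPhysics.KineticTheory.HeatConduction.pinnedChain
                      ω₂ lam β γ).gibbsMeasure N T)) ≤ ε := by
  intro ω₂ lam β γ hω hl hβ hγ T hT hwit ε hε
  obtain ⟨τ₀, hτ₀, h⟩ := stub_anchoredPostDarkStability ω₂ lam β γ hω hl hβ hγ T hT hwit ε hε
  refine ⟨τ₀, hτ₀, fun τ hτ => ?_⟩
  obtain ⟨N₀, hN₀⟩ := h τ hτ
  exact ⟨N₀, fun N hN hN2 => (abs_sub_le_iff.1 (hN₀ N hN hN2)).1⟩

/-- **S5l `stub_anchoredPostDarkLower`** (rev-3 registered half; verbatim) — DERIVED: the lower side of S5. -/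
theorem stub_anchoredPostDarkLower :
    ∀ ω₂ lam β γ : ℝ, 0 < ω₂ → 0 < lam → 0 < β → 0 < γ → ∀ T : ℝ, 0 < T →
      (∃ (μT : MeasureTheory.Measure
              Literature.MathematicalPhysics.KineticTheory.HeatConduction.ChainConfig)
          (D : Literature.MathematicalPhysics.KineticTheory.HeatConduction.InfiniteChainDynamics
            (Literature.MathematicalPhysics.KineticTheory.HeatConduction.pinnedChain ω₂ lam β γ))
          (κ : ℝ),
          (Literature.MathematicalPhysics.KineticTheory.HeatConduction.pinnedChain
              ω₂ lam β γ).IsChainGibbsMeasure T μT ∧ D.PreservesMeasure μT ∧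
          (∀ t : ℝ, D.HasAbsConvergentCorrelation μT t) ∧ 0 < κ ∧
          Filter.Tendsto (fun ν : ℝ => (T ^ 2)⁻¹ *
            MeasureTheory.integral (MeasureTheory.volume.restrict (Set.Ioi (0:ℝ)))
              (fun t : ℝ => Real.exp (-(ν * t)) * D.currentCorrelation μT t))
            (nhdsWithin (0:ℝ) (Set.Ioi 0)) (nhds κ)) →
      ∀ ε : ℝ, 0 < ε → ∃ τ₀ : ℝ, 0 < τ₀ ∧ ∀ τ : ℝ, τ₀ ≤ τ → ∃ N₀ : ℕ, ∀ (N : ℕ), N₀ ≤ N →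
        ∀ hN : 2 ≤ N,
          (∑ k : Fin N, ∫ t in Set.Ioc (0 : ℝ) τ, (1 - t / τ) ^ 2 *
              ∫ z, (Literature.MathematicalPhysics.KineticTheory.HeatConduction.pinnedChain
                      ω₂ lam β γ).bondCurrent N ⟨(N - 1) / 2, by omega⟩ z *
                (∫ y, (Literature.MathematicalPhysics.KineticTheory.HeatConduction.pinnedChain
                      ω₂ lam β γ).bondCurrent N k y
                  ∂((Literature.MathematicalPhysics.KineticTheory.HeatConduction.pinnedChain
                      ω₂ lam β γ).transitionKernel N T T t.toNNReal z))
              ∂((Literature.MathematicalPhysics.KineticTheory.HeatConduction.pinnedChain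
                      ω₂ lam β γ).gibbsMeasure N T)) -
            (∑ k : Fin N, ∫ t in Set.Ioi (0 : ℝ),
              ∫ z, (Literature.MathematicalPhysics.KineticTheory.HeatConduction.pinnedChain
                      ω₂ lam β γ).bondCurrent N ⟨(N - 1) / 2, by omega⟩ z *
                (∫ y, (Literature.MathematicalPhysics.KineticTheory.HeatConduction.pinnedChain
                      ω₂ lam β γ).bondCurrent N k y
                  ∂((Literature.MathematicalPhysics.KineticTheory.HeatConduction.pinnedChain
                      ω₂ lam β γ).transitionKernel N T T t.toNNReal z))
              ∂((Literature.MathematicalPhysics.KineticTheory.HeatConduction.pinnedChain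
                      ω₂ lam β γ).gibbsMeasure N T)) ≤ ε := by
  intro ω₂ lam β γ hω hl hβ hγ T hT hwit ε hε
  obtain ⟨τ₀, hτ₀, h⟩ := stub_anchoredPostDarkStability ω₂ lam β γ hω hl hβ hγ T hT hwit ε hε
  refine ⟨τ₀, hτ₀, fun τ hτ => ?_⟩
  obtain ⟨N₀, hN₀⟩ := h τ hτ
  exact ⟨N₀, fun N hN hN2 => (abs_sub_le_iff.1 (hN₀ N hN hN2)).2⟩

/-! ## The window scheme (rev 3, kept; used by B's worker as a template) -/

/-- Real-variable scheme behind the line: if `g τ → L` (`τ → ∞`; the closed-chain compact-horizon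
witness), `W N τ → g τ` for each fixed `τ > 0` (`N → ∞`; fixed-horizon matching) and
`|d N - W N τ| ≤ ε` for `τ ≥ τ₀(ε)` and `N ≥ N₀(ε, τ)` (post-dark stability, (R) order), then
`d N → L`. (Planner's lemma, reproduced.) -/
theorem tendsto_of_window_scheme {d : ℕ → ℝ} {W : ℕ → ℝ → ℝ} {g : ℝ → ℝ} {L : ℝ}
    (hg : Tendsto g atTop (𝓝 L))
    (hW : ∀ τ : ℝ, 0 < τ → Tendsto (fun N => W N τ) atTop (𝓝 (g τ)))
    (hS : ∀ ε : ℝ, 0 < ε → ∃ τ₀ : ℝ, 0 < τ₀ ∧ ∀ τ : ℝ, τ₀ ≤ τ → ∃ N₀ : ℕ, ∀ N : ℕ, N₀ ≤ N →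
      |d N - W N τ| ≤ ε) :
    Tendsto d atTop (𝓝 L) := by
  rw [Metric.tendsto_atTop]
  intro ε hε
  have hε4 : 0 < ε / 4 := by positivity
  obtain ⟨τ₀, hτ₀, hτ⟩ := hS (ε / 4) hε4
  obtain ⟨τ₁, hτ₁⟩ := (Metric.tendsto_atTop.mp hg) (ε / 4) hε4
  set τ : ℝ := max τ₀ τ₁ with hτdef
  have hτpos : 0 < τ := lt_of_lt_of_le hτ₀ (le_max_left _ _)
  obtain ⟨N₀, hN₀⟩ := hτ τ (le_max_left _ _)
  obtain ⟨N₁, hN₁⟩ := (Metric.tendsto_atTop.mp (hW τ hτpos)) (ε / 4) hε4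
  refine ⟨max N₀ N₁, fun N hN => ?_⟩
  have h1 : |d N - W N τ| ≤ ε / 4 := hN₀ N (le_trans (le_max_left _ _) hN)
  have h2 : |W N τ - g τ| < ε / 4 := by
    have := hN₁ N (le_trans (le_max_right _ _) hN)
    rwa [Real.dist_eq] at this
  have h3 : |g τ - L| < ε / 4 := by
    have := hτ₁ τ (le_max_right _ _)
    rwa [Real.dist_eq] at this
  rw [Real.dist_eq]
  calc |d N - L| = |(d N - W N τ) + (W N τ - g τ) + (g τ - L)| := by ring_nf
    _ ≤ |(d N - W N τ) + (W N τ - g τ)| + |g τ - L| := abs_add_le _ _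
    _ ≤ |d N - W N τ| + |W N τ - g τ| + |g τ - L| := by
        gcongr
        exact abs_add_le _ _
    _ < ε / 4 + ε / 4 + ε / 4 := by linarith
    _ ≤ ε := by linarith

/-! ## rev 5: the canonical steady family, NECESSITY of CLB given a witness, the REPAIRED crux from (R) alone -/

/-- **The canonical steady family and its responses at `T`.**  For `P` (all `> 0`), weak-NESS uniqueness and `T > 0`
there is a steady-state family (CEHR 2018: `pinnedChain_exists_isSteadyState`, landed; junk `0` at non-positive bath
temperatures, where the family clause asks nothing) together with its response coefficients at `T`
(`finiteResponse_of_unique`, landed: Kundu–Dhar–Narayan open-chain Green–Kubo identity). -/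
theorem exists_steadyFamily_response (ω₂ lam β γ : ℝ) (hω : 0 < ω₂) (hl : 0 < lam) (hβ : 0 < β) (hγ : 0 < γ)
    (hU : ∀ (N : ℕ) (T_L T_R : ℝ), 0 < T_L → 0 < T_R → ∀ μ ν : Measure (PhaseSpace N),
      (pinnedChain ω₂ lam β γ).IsSteadyState N T_L T_R μ → (pinnedChain ω₂ lam β γ).IsSteadyState N T_L T_R ν → μ = ν)
    (T : ℝ) (hT : 0 < T) :
    ∃ (μ : (N : ℕ) → ℝ → ℝ → Measure (PhaseSpace N)) (Dn : ℕ → ℝ),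
      (∀ (N : ℕ) (T_L T_R : ℝ), 0 < T_L → 0 < T_R →
        (pinnedChain ω₂ lam β γ).IsSteadyState N T_L T_R (μ N T_L T_R)) ∧
      ∀ N : ℕ, Tendsto (fun δ : ℝ => (pinnedChain ω₂ lam β γ).totalCurrent (μ N (T + δ / 2) (T - δ / 2)) / δ)
        (nhdsWithin 0 {(0 : ℝ)}ᶜ) (𝓝 (Dn N)) := by
  classical
  have hex : ∀ (N : ℕ) (T_L T_R : ℝ), ∃ μ : Measure (PhaseSpace N),
      0 < T_L → 0 < T_R → (pinnedChain ω₂ lam β γ).IsSteadyState N T_L T_R μ := by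
    intro N T_L T_R
    by_cases h : 0 < T_L ∧ 0 < T_R
    · obtain ⟨μ, hμ⟩ := pinnedChain_exists_isSteadyState hω hl hβ hγ N h.1 h.2
      exact ⟨μ, fun _ _ => hμ⟩
    · exact ⟨0, fun h1 h2 => (h ⟨h1, h2⟩).elim⟩
  choose μ hμ using hex
  have hD := Summit.AtomisticToContinuum.FouriersLaw.Theorems.FourierGreenKubo.finiteResponse_of_unique
    ω₂ lam β γ hω hl hβ hγ hU μ hμ T hT
  choose Dn hDn using hD
  exact ⟨μ, Dn, hμ, hDn⟩

/-- **NECESSITY of the positivity half (uses nothing).**  The crux implies, at every `T > 0` carrying an Abelian Green–Kubo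
witness, the conclusion of `ConductanceLowerBound` at `T`: along every steady family with responses `Dn`,
`Dn N ≥ c > 0` eventually (`c = κ/2`, from `Dn → κ > 0`).  With `AbelThermodynamicLimit_of` this certifies: modulo (R),
crux ⟺ [witness ⇒ `liminf_N D_N > 0`]; the seam SI is sufficient, not necessary. -/
theorem lowerBound_of_crux
    (h : Summit.AtomisticToContinuum.FouriersLaw.Theses.EmbeddedDrudeMourre.AbelThermodynamicLimit) :
    ∀ ω₂ lam β γ : ℝ, 0 < ω₂ → 0 < lam → 0 < β → 0 < γ →
      (∀ (N : ℕ) (T_L T_R : ℝ), 0 < T_L → 0 < T_R → ∀ μ ν : Measure (PhaseSpace N),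
        (pinnedChain ω₂ lam β γ).IsSteadyState N T_L T_R μ →
        (pinnedChain ω₂ lam β γ).IsSteadyState N T_L T_R ν → μ = ν) →
      ∀ T : ℝ, 0 < T →
        (∃ (μT : Measure ChainConfig) (D : InfiniteChainDynamics (pinnedChain ω₂ lam β γ)) (κ : ℝ),
          (pinnedChain ω₂ lam β γ).IsChainGibbsMeasure T μT ∧ D.PreservesMeasure μT ∧
          (∀ t : ℝ, D.HasAbsConvergentCorrelation μT t) ∧ 0 < κ ∧
          Tendsto (fun ν : ℝ => (T ^ 2)⁻¹ *
            MeasureTheory.integral (MeasureTheory.volume.restrict (Set.Ioi (0:ℝ)))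
              (fun t : ℝ => Real.exp (-(ν * t)) * D.currentCorrelation μT t))
            (nhdsWithin (0:ℝ) (Set.Ioi 0)) (𝓝 κ)) →
        ∀ μ : (N : ℕ) → ℝ → ℝ → Measure (PhaseSpace N),
          (∀ (N : ℕ) (T_L T_R : ℝ), 0 < T_L → 0 < T_R →
            (pinnedChain ω₂ lam β γ).IsSteadyState N T_L T_R (μ N T_L T_R)) →
          ∀ Dn : ℕ → ℝ,
            (∀ N : ℕ, Tendsto (fun δ : ℝ =>
                (pinnedChain ω₂ lam β γ).totalCurrent (μ N (T + δ / 2) (T - δ / 2)) / δ)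
              (nhdsWithin 0 {(0 : ℝ)}ᶜ) (𝓝 (Dn N))) →
            ∃ c : ℝ, 0 < c ∧ ∃ N₁ : ℕ, ∀ N : ℕ, N₁ ≤ N → c ≤ Dn N := by
  intro ω₂ lam β γ hω hl hβ hγ hU T hT hwit μ hμ Dn hDn
  obtain ⟨μT, D, κ, ⟨-, -, -, hκ, -⟩, hfam⟩ := h ω₂ lam β γ hω hl hβ hγ hU T hT hwit
  have hlim : Tendsto Dn atTop (𝓝 κ) := hfam μ hμ Dn hDn
  have hev : ∀ᶠ N in atTop, κ / 2 ≤ Dn N :=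
    hlim.eventually (eventually_ge_nhds (by linarith : κ / 2 < κ))
  obtain ⟨N₁, hN₁⟩ := hev.exists_forall_of_atTop
  exact ⟨κ / 2, by positivity, N₁, hN₁⟩

/-- **Common-limit lemma (modulo the stub (R) only).**  For `P` (all `> 0`), weak-NESS uniqueness and `T > 0` there are a
REGULAR pair `(μ*, D*)` (DLR + shift-invariant + superstable state, carrier `⊆ bmGood`, `μ*`-preserving, absolutely convergent
correlations) and a real `L` with: `∫₀^∞ e^{-νt} C_{D*}(t) dt → L` (`ν ↓ 0`) and, along EVERY steady family with responses
`Dn` at `T`, `T² · Dn N → L`.  ((M) fed S7, A fed (R), S3 fed `Uniq`.) -/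
theorem exists_regularPair_commonLimit (ω₂ lam β γ : ℝ) (hω : 0 < ω₂) (hl : 0 < lam) (hβ : 0 < β) (hγ : 0 < γ)
    (hU : ∀ (N : ℕ) (T_L T_R : ℝ), 0 < T_L → 0 < T_R → ∀ μ ν : Measure (PhaseSpace N),
      (pinnedChain ω₂ lam β γ).IsSteadyState N T_L T_R μ → (pinnedChain ω₂ lam β γ).IsSteadyState N T_L T_R ν → μ = ν)
    (T : ℝ) (hT : 0 < T) :
    ∃ (μT : Measure ChainConfig) (D : InfiniteChainDynamics (pinnedChain ω₂ lam β γ)) (L : ℝ),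
      (pinnedChain ω₂ lam β γ).IsChainGibbsMeasure T μT ∧ IsShiftInvariant μT ∧
      (pinnedChain ω₂ lam β γ).HasSuperstabilityEstimate μT ∧ D.carrier ⊆ (pinnedChain ω₂ lam β γ).bmGood ∧
      D.PreservesMeasure μT ∧ (∀ t : ℝ, D.HasAbsConvergentCorrelation μT t) ∧
      Tendsto (fun ν : ℝ => MeasureTheory.integral (MeasureTheory.volume.restrict (Set.Ioi (0:ℝ)))
          (fun t : ℝ => Real.exp (-(ν * t)) * D.currentCorrelation μT t))
        (nhdsWithin (0:ℝ) (Set.Ioi 0)) (𝓝 L) ∧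
      ∀ (μ : (N : ℕ) → ℝ → ℝ → Measure (PhaseSpace N)) (Dn : ℕ → ℝ),
        (∀ (N : ℕ) (T_L T_R : ℝ), 0 < T_L → 0 < T_R →
          (pinnedChain ω₂ lam β γ).IsSteadyState N T_L T_R (μ N T_L T_R)) →
        (∀ N : ℕ, Tendsto (fun δ : ℝ =>
            (pinnedChain ω₂ lam β γ).totalCurrent (μ N (T + δ / 2) (T - δ / 2)) / δ)
          (nhdsWithin 0 {(0 : ℝ)}ᶜ) (𝓝 (Dn N))) →
        Tendsto (fun N => T ^ 2 * Dn N) atTop (𝓝 L) := by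
  obtain ⟨μT, D, hG, hS, hss, hcar, hP, hAC⟩ := exists_regularPair ω₂ lam β γ hω hl hβ hγ T hT
  have hM := stub_fixedFrequencyMatching ω₂ lam β γ hω hl hβ hγ T hT
    (stub_regularDLRUnique ω₂ lam β γ hω hl hβ hγ T hT) μT D hG hS hss hcar hP hAC
  obtain ⟨L, hA, hL⟩ := stub_anchoredDcLimitOfRegularity ω₂ lam β γ hω hl hβ hγ T hT
    (stub_uniformAbelianRegularity ω₂ lam β γ hω hl hβ hγ T hT) _ hM
  refine ⟨μT, D, L, hG, hS, hss, hcar, hP, hAC, hL, fun μ Dn hμ hDn => ?_⟩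
  have hKq := stub_anchoredKubo ω₂ lam β γ hω hl hβ hγ hU T hT μ Dn hμ hDn
  refine hA.congr' ?_
  filter_upwards [eventually_ge_atTop 2] with N hN
  rw [dif_pos hN]
  exact (hKq N hN).2.symm

/-- **The REPAIRED crux from (R) alone (the seam route, kept sorry-free modulo (R)).**  If the HYPOTHESIS witness clause carries
`IsShiftInvariant μT` (the planner-level repair recommended by every seat of this crux), the crux follows from (R) and the
landed theorems WITHOUT CLB: a shift-invariant DLR state is one-site tight, hence the transfer-operator state and superstable
(`InfiniteChainTightRegular`); `regularWitness_of_regularState_of_aeOrbits` makes the carrier `⊆ bmGood`; for this regular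
witness (M) + A[(R)] pin `L = T²κ > 0`, and S3 gives `Dn → κ`. -/
theorem AbelThermodynamicLimitSI_of :
    ∀ ω₂ lam β γ : ℝ, 0 < ω₂ → 0 < lam → 0 < β → 0 < γ →
      (∀ (N : ℕ) (T_L T_R : ℝ), 0 < T_L → 0 < T_R → ∀ μ ν : Measure (PhaseSpace N),
        (pinnedChain ω₂ lam β γ).IsSteadyState N T_L T_R μ →
        (pinnedChain ω₂ lam β γ).IsSteadyState N T_L T_R ν → μ = ν) →
      ∀ T : ℝ, 0 < T →
        (∃ (μT : Measure ChainConfig) (D : InfiniteChainDynamics (pinnedChain ω₂ lam β γ)) (κ : ℝ),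
          (pinnedChain ω₂ lam β γ).IsChainGibbsMeasure T μT ∧ IsShiftInvariant μT ∧ D.PreservesMeasure μT ∧
          (∀ t : ℝ, D.HasAbsConvergentCorrelation μT t) ∧ 0 < κ ∧
          Tendsto (fun ν : ℝ => (T ^ 2)⁻¹ *
            MeasureTheory.integral (MeasureTheory.volume.restrict (Set.Ioi (0:ℝ)))
              (fun t : ℝ => Real.exp (-(ν * t)) * D.currentCorrelation μT t))
            (nhdsWithin (0:ℝ) (Set.Ioi 0)) (𝓝 κ)) →
        ∃ (μT : Measure ChainConfig) (D : InfiniteChainDynamics (pinnedChain ω₂ lam β γ)) (κ : ℝ),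
          ((pinnedChain ω₂ lam β γ).IsChainGibbsMeasure T μT ∧ D.PreservesMeasure μT ∧
            (∀ t : ℝ, D.HasAbsConvergentCorrelation μT t) ∧ 0 < κ ∧
            Tendsto (fun ν : ℝ => (T ^ 2)⁻¹ *
              MeasureTheory.integral (MeasureTheory.volume.restrict (Set.Ioi (0:ℝ)))
                (fun t : ℝ => Real.exp (-(ν * t)) * D.currentCorrelation μT t))
              (nhdsWithin (0:ℝ) (Set.Ioi 0)) (𝓝 κ)) ∧
          ∀ μ : (N : ℕ) → ℝ → ℝ → Measure (PhaseSpace N),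
            (∀ (N : ℕ) (T_L T_R : ℝ), 0 < T_L → 0 < T_R →
              (pinnedChain ω₂ lam β γ).IsSteadyState N T_L T_R (μ N T_L T_R)) →
            ∀ Dn : ℕ → ℝ,
              (∀ N : ℕ, Tendsto (fun δ : ℝ =>
                  (pinnedChain ω₂ lam β γ).totalCurrent (μ N (T + δ / 2) (T - δ / 2)) / δ)
                (nhdsWithin 0 {(0 : ℝ)}ᶜ) (𝓝 (Dn N))) →
              Tendsto Dn atTop (𝓝 κ) := by
  intro ω₂ lam β γ hω hl hβ hγ hU T hT hwit
  obtain ⟨μ₁, D₁, κ₁, hG₁, hS₁, hP₁, hAC₁, hκ₁, hlim₁⟩ := hwit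
  haveI : IsProbabilityMeasure μ₁ := hG₁.isProbabilityMeasure
  obtain ⟨-, hss₁⟩ :=
    OscillatorChain.isShiftInvariant_and_hasSuperstabilityEstimate_of_tight_pinnedChain γ hω hl.le hβ.le hT hG₁
      (oneSiteTight_of_isShiftInvariant hS₁)
  have horb : ∀ᵐ σ ∂μ₁, ∀ t : ℝ, D₁.flow t σ ∈ (pinnedChain ω₂ lam β γ).bmGood :=
    OscillatorChain.ae_forall_flow_mem_bmGood_pinnedChain γ hω.le hl hβ hss₁ D₁ hP₁
  obtain ⟨μT, D, κ, hG, hS, hss, hcar, hP, hAC, hκ, hAbel⟩ :=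
    Summit.AtomisticToContinuum.FouriersLaw.Theorems.GreenKuboContinuation.TemperatureBlindVitaliHurwitz.regularWitness_of_regularState_of_aeOrbits
      D₁ hG₁ hP₁ hAC₁ hκ₁ hlim₁ hS₁ hss₁ horb
  refine ⟨μT, D, κ, ⟨hG, hP, hAC, hκ, hAbel⟩, ?_⟩
  intro μ hμ Dn hDn
  have hT2 : (T ^ 2) ≠ 0 := pow_ne_zero 2 hT.ne'
  have hM := stub_fixedFrequencyMatching ω₂ lam β γ hω hl hβ hγ T hT
    (stub_regularDLRUnique ω₂ lam β γ hω hl hβ hγ T hT) μT D hG hS hss hcar hP hAC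
  obtain ⟨L, hA, hL⟩ := stub_anchoredDcLimitOfRegularity ω₂ lam β γ hω hl hβ hγ T hT
    (stub_uniformAbelianRegularity ω₂ lam β γ hω hl hβ hγ T hT) _ hM
  have hAbel' : Tendsto (fun ν : ℝ => ∫ t in Ioi (0 : ℝ),
      Real.exp (-(ν * t)) * D.currentCorrelation μT t) (𝓝[>] 0) (𝓝 (T ^ 2 * κ)) := by
    have h := hAbel.const_mul (T ^ 2)
    simp only [← mul_assoc, mul_inv_cancel₀ hT2, one_mul] at h
    exact h
  have hLκ : L = T ^ 2 * κ := tendsto_nhds_unique hL hAbel'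
  have hKq := stub_anchoredKubo ω₂ lam β γ hω hl hβ hγ hU T hT μ Dn hμ hDn
  have hd : (fun N : ℕ => if hN : 2 ≤ N then
      ∑ k : Fin N, ∫ t in Set.Ioi (0 : ℝ),
        ∫ z, (pinnedChain ω₂ lam β γ).bondCurrent N ⟨(N - 1) / 2, by omega⟩ z *
          (∫ y, (pinnedChain ω₂ lam β γ).bondCurrent N k y
            ∂((pinnedChain ω₂ lam β γ).transitionKernel N T T t.toNNReal z))
        ∂((pinnedChain ω₂ lam β γ).gibbsMeasure N T) else 0) =ᶠ[atTop] fun N => T ^ 2 * Dn N := by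
    filter_upwards [eventually_ge_atTop 2] with N hN
    rw [dif_pos hN]
    exact (hKq N hN).2.symm
  have hlim : Tendsto (fun N => T ^ 2 * Dn N) atTop (𝓝 (T ^ 2 * κ)) := by
    rw [← hLκ]
    exact hA.congr' hd
  have := hlim.const_mul ((T ^ 2)⁻¹)
  simpa [← mul_assoc, inv_mul_cancel₀ hT2] using this

/-! ## The composition (kernel-checked, no `sorry` outside the stubs (R), CLB): regular pair + (M) + A[(R)] + S3 + CLB -/

/-- **Skeleton theorem**: the crux BY NAME (rev 5).  Proof: `exists_regularPair_commonLimit` (regular pair `(μ*, D*)`, common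
limit `L` of `∫₀^∞ e^{-νt}C_{D*}` at `0⁺` and of `T²·Dn N` along every steady family; uses (R)); positivity `0 < L` from CLB
along the CANONICAL steady family (`exists_steadyFamily_response`): `T²·Dc N → L` and `Dc N ≥ c > 0` eventually; OUTPUT the
witness `(μ*, D*, L/T²)`; finally `Dn N = (T²)⁻¹ (T² Dn N) → L/T²` along the given family.  The crux's own witness hypothesis
is not used (it is `γ`-blind, Disproof §2a). -/
theorem AbelThermodynamicLimit_of :
    Summit.AtomisticToContinuum.FouriersLaw.Theses.EmbeddedDrudeMourre.AbelThermodynamicLimit := by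
  intro ω₂ lam β γ hω hl hβ hγ hU T hT _hwit
  have hT2 : (T ^ 2) ≠ 0 := pow_ne_zero 2 hT.ne'
  have hT2pos : 0 < T ^ 2 := pow_pos hT 2
  obtain ⟨μT, D, L, hG, -, -, -, hP, hAC, hL, hKubo⟩ :=
    exists_regularPair_commonLimit ω₂ lam β γ hω hl hβ hγ hU T hT
  -- positivity of `L` from ConductanceLowerBound along the canonical family
  obtain ⟨μc, Dc, hμc, hDc⟩ := exists_steadyFamily_response ω₂ lam β γ hω hl hβ hγ hU T hT
  obtain ⟨c, hc, N₁, hN₁⟩ := stub_conductanceLowerBound ω₂ lam β γ hω hl hβ hγ hU μc hμc T hT Dc hDc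
  have hLpos : 0 < L := by
    have h1 : T ^ 2 * c ≤ L := by
      refine ge_of_tendsto (hKubo μc Dc hμc hDc) ?_
      filter_upwards [eventually_ge_atTop N₁] with N hN
      exact mul_le_mul_of_nonneg_left (hN₁ N hN) hT2pos.le
    exact lt_of_lt_of_le (mul_pos hT2pos hc) h1
  -- OUTPUT the witness `(μ*, D*, L/T²)`
  refine ⟨μT, D, (T ^ 2)⁻¹ * L, ⟨hG, hP, hAC, mul_pos (inv_pos.2 hT2pos) hLpos, hL.const_mul _⟩, ?_⟩
  intro μ hμ Dn hDn
  have := (hKubo μ Dn hμ hDn).const_mul ((T ^ 2)⁻¹)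
  simpa [← mul_assoc, inv_mul_cancel₀ hT2] using this



end LoomisCompactHorizonWitness

end Summit.AtomisticToContinuum.FouriersLaw.Cruxes.AbelThermodynamicLimit

end
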